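import Literature.Computability.QuantumComplexity.ForrelationDerivativeTables
import HarnessLib

/-!
# Sign transport for exactly forrelated pairs (Poisson summation over cosets)

Topic `Literature/Computability/QuantumComplexity` (family `quantum-advantage`; written by the refuter seat
`refuter-cdisprove-stmt-QuantumAdvantage-13932-0`, 2026-08-16, as the mathematical core of its attack on
the crux `SignedExactCubicForrelationNotPrBPP` of route `QuantumAdvantage/CubicForrelation`, item
stmt-QuantumAdvantage-13932). EVERYTHING here is a theorem (no definitions, no named facts); it extends the
`DerivativeWalsh` development of `ForrelationDerivativeTables.lean` (`W`, `fsum`).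

For `±1`-valued `f, g : {0,1}ⁿ → ℝ` with `S(f,g)² = 8ⁿ` (equivalently `Φ(f,g) = ±1`: `g` is bent and its
dual sign pattern is `±f`) and for EVERY linear subspace `U ≤ 𝔽₂ⁿ` (a finset of bit vectors containing `0`
and closed under `⊕`) and every shift `r`:

  `2ⁿ · |U| · ∑_{y ∈ r + U^⊥} g(y) = S(f,g) · ∑_{x ∈ U} (-1)^{x·r} f(x)`       (`sign_transport`)

(`U^⊥ = {y : (-1)^{x·y} = 1 ∀ x ∈ U}`; the coset `r + U^⊥` is `{y : r ⊕ y ∈ U^⊥}`). Read through `signOf`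
for Boolean `a, b` with `forrelation a b = 1` resp. `-1` this is

  `|U| · ∑_{y ∈ r+U^⊥} (-1)^{b(y)} = ± 2^{n/2} · ∑_{x ∈ U} (-1)^{a(x) + x·r}`
  (`coset_sum_eq_of_forrelation_eq_one`, `coset_sum_eq_of_forrelation_eq_neg_one`),

so the SIGN of `Φ` is the product of the signs of the two restricted sums, for any `U` and any `r` making
them non-zero (`sign_rule_of_forrelation_eq_one`, `sign_rule_of_forrelation_eq_neg_one`), and such an `r`
exists (`exists_twist_sum_ne_zero`, Parseval on `U`).

## Contents (all proved)

* `twist_bxor_left`, `sum_twist_subspace` (character sums over a subspace: `|U|·[y ∈ U^⊥]`),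
  `card_mul_sum_coset` (Poisson summation over a coset of `U^⊥`, any real `g`);
* `sum_W_sq` (Parseval for `W`), `two_pow_mul_W_eq` (`S² = 8ⁿ ⇒ 2ⁿ W_g = S · f` pointwise, the
  Cauchy–Schwarz equality case via a sum of squares — the pointwise sharpening of
  `dwt_transpose_of_fsum_sq`);
* `sign_transport`, `exists_twist_sum_ne_zero`; Boolean forms `fsum_signOf_eq`,
  `fsum_signOf_sq_of_forrelation_sq`, `coset_sum_eq_of_forrelation_eq_one`/`_neg_one`,
  `sign_rule_of_forrelation_eq_one`/`_neg_one`; white-box instances `instance_coset_sum_of_value_eq_one`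
  /`_neg_one` (`I.k = 2`, `I.value = ±1`).

## Why it matters (prose; the complexity statement is NOT formalised here)

For CUBIC `a, b` call `U` bi-isotropic when the cubic part of `a` vanishes on `U` (`a` quadratic on every
coset of `U`) and the cubic part of `b` vanishes on `U^⊥`. Then both restricted sums are quadratic Gauss
sums over `𝔽₂` — exact, signed, polynomial time by variable elimination (Dickson) — and the set of good `r`
is an explicit affine subspace. Hence deciding the signed exact slice `Φ = 1` vs `Φ = -1` of cubic 2-fold
Forrelation (Aaronson–Ambainis 2018, §3.2 Prop. 6 decides it with ONE quantum query pair) reduces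
classically to FINDING a bi-isotropic subspace of the pair of cubic coefficient tensors; for
Maiorana–McFarland pairs every M-subspace `V` of `b` gives one (`U = V^⊥`, McFarland/Dillon duality). What
is deliberately NOT here: subspaces as `Submodule (ZMod 2)`, the quadratic Gauss-sum evaluation, any
`PromiseBPP'` statement (needs an `FP`/`TM2` witness), the M-subspace finder (a heuristic; kit evidence on
the item).

## References

* [AaronsonAmbainis2018] S. Aaronson, A. Ambainis, Forrelation, SIAM J. Comput. 47 (2018), §1.1.1 (`Φ`),
  §3.2 Prop. 6 (acceptance `(1+Φ)/2`).
* [ODonnell2014] R. O'Donnell, Analysis of Boolean Functions (2014), §1.4 (characters, Parseval) and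
  §3.3 (restrictions / Poisson summation over cosets).
* R. L. McFarland, A family of difference sets in non-cyclic groups, JCTA 15 (1973); J. F. Dillon,
  Elementary Hadamard difference sets (1974) — duals of Maiorana–McFarland bent functions (orientation).
-/

noncomputable section

namespace Literature.Computability.QuantumComplexity

namespace DerivativeWalsh

open Finset
open Literature.Computability.QuantumComplexity.BuzetChailloux
open Literature.Computability.QuantumComplexity.Simon (twist_mul_self twist_eq_one_or sum_twist)

variable {n : ℕ}

/-! ### Character sums over a subspace and Poisson summation over a coset -/

/-- `(-1)^{(a ⊕ b)·y} = (-1)^{a·y} (-1)^{b·y}`: the `bxor`-phrased form (for `rw`/`simp` on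
`twist (bxor a b) y`) of `Simon.twist_xor_left` (`SimonFourier.lean`), to which it reduces by `rfl`
on `bxor` (dedup-01298). [cite: ODonnell2014, §1.4] -/
theorem twist_bxor_left (a b y : Fin n → Bool) : twist (bxor a b) y = twist a y * twist b y :=
  Simon.twist_xor_left a b y

/-- **Character sum over a subspace**: if `U ∋ 0` is closed under `⊕` then
`∑_{x ∈ U} (-1)^{x·y} = |U| · [ (-1)^{x·y} = 1 for all x ∈ U ]` (if some `x₀ ∈ U` has `(-1)^{x₀·y} = -1`,
reindexing by `x ↦ x₀ ⊕ x` negates the sum). [cite: ODonnell2014, §3.3] -/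
theorem sum_twist_subspace {U : Finset (Fin n → Bool)} (hadd : ∀ x ∈ U, ∀ y ∈ U, bxor x y ∈ U)
    (y : Fin n → Bool) :
    ∑ x ∈ U, twist x y = if (∀ x ∈ U, twist x y = 1) then (U.card : ℝ) else 0 := by
  split_ifs with hy
  · rw [sum_congr rfl hy, sum_const, nsmul_eq_mul, mul_one]
  · obtain ⟨x₀, hx₀, hne⟩ : ∃ x₀ ∈ U, twist x₀ y ≠ 1 := by
      by_contra h
      push Not at h
      exact hy h
    have hneg : twist x₀ y = -1 := (twist_eq_one_or x₀ y).resolve_left hne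
    have key : ∑ x ∈ U, twist (bxor x₀ x) y = ∑ x ∈ U, twist x y :=
      Finset.sum_nbij' (fun x => bxor x₀ x) (fun x => bxor x₀ x)
        (fun a ha => hadd x₀ hx₀ a ha) (fun a ha => hadd x₀ hx₀ a ha)
        (fun a _ => bxor_bxor_cancel_left x₀ a) (fun a _ => bxor_bxor_cancel_left x₀ a)
        (fun a _ => rfl)
    have h2 : ∑ x ∈ U, twist (bxor x₀ x) y = twist x₀ y * ∑ x ∈ U, twist x y := by
      rw [mul_sum]
      exact sum_congr rfl fun x _ => twist_bxor_left x₀ x y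
    have h3 := key.symm.trans h2
    rw [hneg] at h3
    linarith

/-- **Poisson summation over a coset of `U^⊥`** (any real `g`, `U` closed under `⊕`):
`|U| · ∑_{y : r ⊕ y ∈ U^⊥} g(y) = ∑_{x ∈ U} (-1)^{x·r} W_g(x)`. [cite: ODonnell2014, §3.3] -/
theorem card_mul_sum_coset {U : Finset (Fin n → Bool)} (hadd : ∀ x ∈ U, ∀ y ∈ U, bxor x y ∈ U)
    (g : (Fin n → Bool) → ℝ) (r : Fin n → Bool) :
    (U.card : ℝ) * ∑ y ∈ univ.filter (fun y => ∀ x ∈ U, twist x (bxor r y) = 1), g y =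
      ∑ x ∈ U, twist x r * W g x := by
  have h1 : ∀ x ∈ U, twist x r * W g x = ∑ y, g y * twist x (bxor r y) := by
    intro x _
    rw [W, mul_sum]
    refine sum_congr rfl fun y _ => ?_
    rw [twist_bxor_right, twist_comm y x]
    ring
  rw [sum_congr rfl h1, sum_comm]
  have h2 : ∀ y : Fin n → Bool, ∑ x ∈ U, g y * twist x (bxor r y) =
      if (∀ x ∈ U, twist x (bxor r y) = 1) then (U.card : ℝ) * g y else 0 := by
    intro y
    rw [← mul_sum, sum_twist_subspace hadd]
    split_ifs <;> ring
  rw [sum_congr rfl fun y _ => h2 y, ← sum_filter, mul_sum]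

/-! ### Parseval for `W` and the pointwise duality from `S² = 8ⁿ` -/

/-- Parseval: `∑_x W_g(x)² = 2ⁿ ∑_y g(y)²`. [cite: ODonnell2014, §1.4] -/
theorem sum_W_sq (g : (Fin n → Bool) → ℝ) : ∑ x, W g x ^ 2 = (2 : ℝ) ^ n * ∑ y, g y ^ 2 := by
  have e1 : ∀ x : Fin n → Bool, W g x ^ 2 = ∑ y, ∑ y', g y * g y' * twist (bxor y y') x := by
    intro x
    rw [W, sq, sum_mul_sum]
    refine sum_congr rfl fun y _ => sum_congr rfl fun y' _ => ?_
    rw [twist_bxor_left]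
    ring
  rw [sum_congr rfl fun x _ => e1 x, sum_comm]
  have e2 : ∀ y : Fin n → Bool,
      ∑ x, ∑ y', g y * g y' * twist (bxor y y') x = (2 : ℝ) ^ n * g y ^ 2 := by
    intro y
    rw [sum_comm]
    have e3 : ∀ y' : Fin n → Bool, ∑ x, g y * g y' * twist (bxor y y') x =
        g y * g y' * (if bxor y y' = zeroVec then (2 : ℝ) ^ n else 0) := by
      intro y'
      rw [← mul_sum]
      congr 1
      simp_rw [twist_comm (bxor y y')]
      exact sum_twist_left _
    rw [sum_congr rfl fun y' _ => e3 y']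
    simp_rw [bxor_eq_zeroVec_iff, mul_ite, mul_zero]
    rw [Finset.sum_ite_eq univ y, if_pos (mem_univ _)]
    ring
  rw [sum_congr rfl fun y _ => e2 y, ← mul_sum]

/-- **Exact duality, pointwise**: for `±1`-valued `f, g` with `S(f,g)² = 8ⁿ` (`Φ = ±1`),
`2ⁿ · W_g(x) = S(f,g) · f(x)` for EVERY `x` — `g` is bent with dual sign pattern `± f` (Cauchy–Schwarz
equality case: `∑_x (2ⁿ W_g(x) - S f(x))² = 16ⁿ - 2·16ⁿ + 16ⁿ = 0`). [cite: AaronsonAmbainis2018, §1.1.1] -/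
theorem two_pow_mul_W_eq (f g : (Fin n → Bool) → ℝ) (hf : ∀ x, f x ^ 2 = 1) (hg : ∀ x, g x ^ 2 = 1)
    (hS : fsum f g ^ 2 = (8 : ℝ) ^ n) (x : Fin n → Bool) :
    (2 : ℝ) ^ n * W g x = fsum f g * f x := by
  have hW : ∑ x, W g x ^ 2 = (4 : ℝ) ^ n := by
    rw [sum_W_sq]
    simp_rw [hg, sum_const, card_univ, Fintype.card_fun, Fintype.card_bool, Fintype.card_fin,
      nsmul_eq_mul, mul_one]
    push_cast
    rw [← mul_pow]
    norm_num
  have hfW : ∑ x, f x * W g x = fsum f g := (fsum_eq_sum_mul_W f g).symm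
  have hff : ∑ x : Fin n → Bool, f x ^ 2 = (2 : ℝ) ^ n := by
    simp_rw [hf, sum_const, card_univ, Fintype.card_fun, Fintype.card_bool, Fintype.card_fin,
      nsmul_eq_mul, mul_one]
    push_cast
    rfl
  have h48 : (4 : ℝ) ^ n * 4 ^ n = 2 ^ n * 8 ^ n := by
    rw [← mul_pow, ← mul_pow]; norm_num
  have htot : ∑ x, ((2 : ℝ) ^ n * W g x - fsum f g * f x) ^ 2 = 0 := by
    have e : ∀ x : Fin n → Bool, ((2 : ℝ) ^ n * W g x - fsum f g * f x) ^ 2 =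
        (4 : ℝ) ^ n * W g x ^ 2 - 2 * 2 ^ n * fsum f g * (f x * W g x) + fsum f g ^ 2 * f x ^ 2 := by
      intro x
      have h4 : (4 : ℝ) ^ n = 2 ^ n * 2 ^ n := by rw [← mul_pow]; norm_num
      rw [h4]
      ring
    simp_rw [e, sum_add_distrib, sum_sub_distrib, ← mul_sum, hW, hfW, hff, hS]
    linear_combination h48 - 2 * 2 ^ n * hS
  have hx := (sum_eq_zero_iff_of_nonneg fun x _ => sq_nonneg _).1 htot x (mem_univ _)
  have : (2 : ℝ) ^ n * W g x - fsum f g * f x = 0 := pow_eq_zero_iff (n := 2) (by norm_num) |>.1 hx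
  linarith

/-! ### Sign transport -/

/-- **Sign transport** (Poisson summation for exactly forrelated pairs). For `±1`-valued `f, g` with
`S(f,g)² = 8ⁿ`, every `U ∋ 0` closed under `⊕`, and every shift `r`:
`2ⁿ · |U| · ∑_{y : r ⊕ y ∈ U^⊥} g(y) = S(f,g) · ∑_{x ∈ U} (-1)^{x·r} f(x)`.
So `sgn S(f,g) = sgn(left sum) · sgn(right sum)` whenever the right sum is non-zero — for ANY `U`.
[cite: AaronsonAmbainis2018, §1.1.1] -/
theorem sign_transport (f g : (Fin n → Bool) → ℝ) (hf : ∀ x, f x ^ 2 = 1) (hg : ∀ x, g x ^ 2 = 1)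
    (hS : fsum f g ^ 2 = (8 : ℝ) ^ n) {U : Finset (Fin n → Bool)}
    (hadd : ∀ x ∈ U, ∀ y ∈ U, bxor x y ∈ U) (r : Fin n → Bool) :
    (2 : ℝ) ^ n * U.card * ∑ y ∈ univ.filter (fun y => ∀ x ∈ U, twist x (bxor r y) = 1), g y =
      fsum f g * ∑ x ∈ U, twist x r * f x := by
  rw [mul_assoc, card_mul_sum_coset hadd g r, mul_sum, mul_sum]
  refine sum_congr rfl fun x _ => ?_
  have hx := two_pow_mul_W_eq f g hf hg hS x
  calc (2 : ℝ) ^ n * (twist x r * W g x) = twist x r * ((2 : ℝ) ^ n * W g x) := by ring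
    _ = twist x r * (fsum f g * f x) := by rw [hx]
    _ = fsum f g * (twist x r * f x) := by ring

/-- **A good shift exists** (Parseval on `U`): for `±1`-valued `f` and non-empty `U` some `r` has
`∑_{x ∈ U} (-1)^{x·r} f(x) ≠ 0`, since `∑_r (∑_{x∈U} (-1)^{x·r} f(x))² = 2ⁿ |U| > 0`.
[cite: ODonnell2014, §1.4] -/
theorem exists_twist_sum_ne_zero {U : Finset (Fin n → Bool)} (hU : U.Nonempty)
    (f : (Fin n → Bool) → ℝ) (hf : ∀ x, f x ^ 2 = 1) :
    ∃ r : Fin n → Bool, ∑ x ∈ U, twist x r * f x ≠ 0 := by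
  by_contra h
  push Not at h
  have hzero : ∑ r : Fin n → Bool, (∑ x ∈ U, twist x r * f x) ^ 2 = 0 := by
    simp [h]
  have hpos : ∑ r : Fin n → Bool, (∑ x ∈ U, twist x r * f x) ^ 2 = (2 : ℝ) ^ n * U.card := by
    have e1 : ∀ r : Fin n → Bool, (∑ x ∈ U, twist x r * f x) ^ 2 =
        ∑ x ∈ U, ∑ x' ∈ U, f x * f x' * twist (bxor x x') r := by
      intro r
      rw [sq, sum_mul_sum]
      refine sum_congr rfl fun x _ => sum_congr rfl fun x' _ => ?_
      rw [twist_bxor_left]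
      ring
    rw [sum_congr rfl fun r _ => e1 r, sum_comm]
    have e2 : ∀ x ∈ U, ∑ r, ∑ x' ∈ U, f x * f x' * twist (bxor x x') r = (2 : ℝ) ^ n * f x ^ 2 := by
      intro x hx
      rw [sum_comm]
      have e3 : ∀ x' ∈ U, ∑ r, f x * f x' * twist (bxor x x') r =
          f x * f x' * (if bxor x x' = zeroVec then (2 : ℝ) ^ n else 0) := by
        intro x' _
        rw [← mul_sum]
        congr 1
        exact sum_twist _
      rw [sum_congr rfl e3]
      simp_rw [bxor_eq_zeroVec_iff, mul_ite, mul_zero]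
      rw [Finset.sum_ite_eq U x, if_pos hx]
      ring
    rw [sum_congr rfl e2, ← mul_sum]
    simp_rw [hf, sum_const, nsmul_eq_mul, mul_one]
  rw [hzero] at hpos
  have hc : (0 : ℝ) < U.card := by exact_mod_cast hU.card_pos
  have : (0 : ℝ) < (2 : ℝ) ^ n * U.card := by positivity
  linarith

/-! ### Boolean data: the two signed cases `Φ = 1` and `Φ = -1` -/

/-- `√(2^{3n}) = 2ⁿ √(2ⁿ)`. [folklore] -/
theorem sqrt_two_pow_three_mul (n : ℕ) :
    Real.sqrt ((2 : ℝ) ^ (3 * n)) = (2 : ℝ) ^ n * Real.sqrt ((2 : ℝ) ^ n) := by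
  rw [show (2 : ℝ) ^ (3 * n) = ((2 : ℝ) ^ n) ^ 2 * (2 : ℝ) ^ n by ring,
    Real.sqrt_mul (by positivity), Real.sqrt_sq (by positivity)]

/-- `S = √(2^{3n}) · Φ` for Boolean data read through `signOf`. [cite: AaronsonAmbainis2018, §1.1.1] -/
theorem fsum_signOf_eq (a b : (Fin n → Bool) → Bool) :
    fsum (fun x => signOf (a x)) (fun y => signOf (b y)) =
      Real.sqrt ((2 : ℝ) ^ (3 * n)) * forrelation a b := by
  rw [← phi_signOf, phi_eq_fsum, ← mul_assoc, mul_inv_cancel₀ (by positivity), one_mul]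

/-- `Φ² = 1 ⇒ S² = 8ⁿ` for Boolean data. [cite: AaronsonAmbainis2018, §1.1.1] -/
theorem fsum_signOf_sq_of_forrelation_sq (a b : (Fin n → Bool) → Bool) (h : forrelation a b ^ 2 = 1) :
    fsum (fun x => signOf (a x)) (fun y => signOf (b y)) ^ 2 = (8 : ℝ) ^ n := by
  rw [fsum_signOf_eq, mul_pow, h, mul_one, Real.sq_sqrt (by positivity), pow_mul]
  norm_num

/-- **Sign transport on a `Φ = 1` pair** (`b` bent with dual `a`): for every `U ∋ 0` closed under `⊕`
and every `r`, `|U| · ∑_{y : r ⊕ y ∈ U^⊥} (-1)^{b(y)} = 2^{n/2} · ∑_{x ∈ U} (-1)^{x·r} (-1)^{a(x)}`.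
[cite: AaronsonAmbainis2018, §1.1.1] -/
theorem coset_sum_eq_of_forrelation_eq_one {a b : (Fin n → Bool) → Bool} (h : forrelation a b = 1)
    {U : Finset (Fin n → Bool)} (hadd : ∀ x ∈ U, ∀ y ∈ U, bxor x y ∈ U) (r : Fin n → Bool) :
    (U.card : ℝ) * ∑ y ∈ univ.filter (fun y => ∀ x ∈ U, twist x (bxor r y) = 1), signOf (b y) =
      Real.sqrt ((2 : ℝ) ^ n) * ∑ x ∈ U, twist x r * signOf (a x) := by
  have key := sign_transport (fun x => signOf (a x)) (fun y => signOf (b y))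
    (fun x => signOf_sq (a x)) (fun y => signOf_sq (b y))
    (fsum_signOf_sq_of_forrelation_sq a b (by rw [h]; norm_num)) hadd r
  rw [fsum_signOf_eq, h, mul_one, sqrt_two_pow_three_mul, mul_assoc, mul_assoc] at key
  have h2 : (0 : ℝ) < (2 : ℝ) ^ n := by positivity
  have := mul_left_cancel₀ h2.ne' key
  simpa [mul_assoc] using this

/-- **Sign transport on a `Φ = -1` pair** (`b` bent with dual `¬a`): the same identity with a minus sign.
[cite: AaronsonAmbainis2018, §1.1.1] -/
theorem coset_sum_eq_of_forrelation_eq_neg_one {a b : (Fin n → Bool) → Bool}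
    (h : forrelation a b = -1) {U : Finset (Fin n → Bool)}
    (hadd : ∀ x ∈ U, ∀ y ∈ U, bxor x y ∈ U) (r : Fin n → Bool) :
    (U.card : ℝ) * ∑ y ∈ univ.filter (fun y => ∀ x ∈ U, twist x (bxor r y) = 1), signOf (b y) =
      -(Real.sqrt ((2 : ℝ) ^ n) * ∑ x ∈ U, twist x r * signOf (a x)) := by
  have key := sign_transport (fun x => signOf (a x)) (fun y => signOf (b y))
    (fun x => signOf_sq (a x)) (fun y => signOf_sq (b y))
    (fsum_signOf_sq_of_forrelation_sq a b (by rw [h]; norm_num)) hadd r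
  rw [fsum_signOf_eq, h, mul_neg_one, sqrt_two_pow_three_mul, neg_mul, mul_assoc, mul_assoc,
    ← mul_neg] at key
  have h2 : (0 : ℝ) < (2 : ℝ) ^ n := by positivity
  have := mul_left_cancel₀ h2.ne' key
  simpa [mul_assoc] using this

/-- **Sign rule, `Φ = 1`**: the two restricted sums have the same sign (their product is `> 0` as soon as
the `a`-side sum is non-zero; `U ∋ 0` closed under `⊕`). [cite: AaronsonAmbainis2018, §1.1.1] -/
theorem sign_rule_of_forrelation_eq_one {a b : (Fin n → Bool) → Bool} (h : forrelation a b = 1)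
    {U : Finset (Fin n → Bool)} (h0 : zeroVec ∈ U) (hadd : ∀ x ∈ U, ∀ y ∈ U, bxor x y ∈ U)
    (r : Fin n → Bool) (hr : ∑ x ∈ U, twist x r * signOf (a x) ≠ 0) :
    0 < (∑ y ∈ univ.filter (fun y => ∀ x ∈ U, twist x (bxor r y) = 1), signOf (b y)) *
      ∑ x ∈ U, twist x r * signOf (a x) := by
  have key := coset_sum_eq_of_forrelation_eq_one h hadd r
  have hcard : (0 : ℝ) < U.card := by exact_mod_cast card_pos.2 ⟨_, h0⟩
  have hsq : 0 < (∑ x ∈ U, twist x r * signOf (a x)) ^ 2 := by positivity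
  have hmul : (U.card : ℝ) *
      ((∑ y ∈ univ.filter (fun y => ∀ x ∈ U, twist x (bxor r y) = 1), signOf (b y)) *
        ∑ x ∈ U, twist x r * signOf (a x)) =
      Real.sqrt ((2 : ℝ) ^ n) * (∑ x ∈ U, twist x r * signOf (a x)) ^ 2 := by
    rw [← mul_assoc, key]; ring
  have hprod : 0 < (U.card : ℝ) *
      ((∑ y ∈ univ.filter (fun y => ∀ x ∈ U, twist x (bxor r y) = 1), signOf (b y)) *
        ∑ x ∈ U, twist x r * signOf (a x)) := by
    rw [hmul]; positivity
  exact pos_of_mul_pos_right hprod hcard.le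

/-- **Sign rule, `Φ = -1`**: the two restricted sums have opposite signs.
[cite: AaronsonAmbainis2018, §1.1.1] -/
theorem sign_rule_of_forrelation_eq_neg_one {a b : (Fin n → Bool) → Bool} (h : forrelation a b = -1)
    {U : Finset (Fin n → Bool)} (h0 : zeroVec ∈ U) (hadd : ∀ x ∈ U, ∀ y ∈ U, bxor x y ∈ U)
    (r : Fin n → Bool) (hr : ∑ x ∈ U, twist x r * signOf (a x) ≠ 0) :
    (∑ y ∈ univ.filter (fun y => ∀ x ∈ U, twist x (bxor r y) = 1), signOf (b y)) *
      ∑ x ∈ U, twist x r * signOf (a x) < 0 := by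
  have key := coset_sum_eq_of_forrelation_eq_neg_one h hadd r
  have hcard : (0 : ℝ) < U.card := by exact_mod_cast card_pos.2 ⟨_, h0⟩
  have hsq : 0 < (∑ x ∈ U, twist x r * signOf (a x)) ^ 2 := by positivity
  have hmul : (U.card : ℝ) *
      ((∑ y ∈ univ.filter (fun y => ∀ x ∈ U, twist x (bxor r y) = 1), signOf (b y)) *
        ∑ x ∈ U, twist x r * signOf (a x)) =
      -(Real.sqrt ((2 : ℝ) ^ n) * (∑ x ∈ U, twist x r * signOf (a x)) ^ 2) := by
    rw [← mul_assoc, key]; ring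
  have hprod : (U.card : ℝ) *
      ((∑ y ∈ univ.filter (fun y => ∀ x ∈ U, twist x (bxor r y) = 1), signOf (b y)) *
        ∑ x ∈ U, twist x r * signOf (a x)) < 0 := by
    rw [hmul, neg_lt_zero]; positivity
  by_contra hge
  push Not at hge
  have := mul_nonneg hcard.le hge
  linarith

/-! ### White-box instances of the signed exact slice -/

/-- On a two-circuit instance with `I.value = 1`, sign transport between the two computed functions:
`|U| · ∑_{y : r ⊕ y ∈ U^⊥} (-1)^{C₁(y)} = 2^{n/2} · ∑_{x ∈ U} (-1)^{x·r} (-1)^{C₀(x)}`.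
[cite: AaronsonAmbainis2018, §1.1.1] -/
theorem instance_coset_sum_of_value_eq_one {I : KForrelationInstance} (hk : I.k = 2) (hv : I.value = 1)
    {U : Finset (Fin I.n → Bool)} (hadd : ∀ x ∈ U, ∀ y ∈ U, bxor x y ∈ U) (r : Fin I.n → Bool) :
    (U.card : ℝ) * ∑ y ∈ univ.filter (fun y => ∀ x ∈ U, twist x (bxor r y) = 1),
        signOf ((I.C (Fin.cast hk.symm 1)).eval y) =
      Real.sqrt ((2 : ℝ) ^ I.n) *
        ∑ x ∈ U, twist x r * signOf ((I.C (Fin.cast hk.symm 0)).eval x) := by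
  refine coset_sum_eq_of_forrelation_eq_one ?_ hadd r
  rw [← KForrelationInstance.value_eq_forrelation hk, hv]

/-- … and on an instance with `I.value = -1`, with the opposite sign. [cite: AaronsonAmbainis2018, §1.1.1] -/
theorem instance_coset_sum_of_value_eq_neg_one {I : KForrelationInstance} (hk : I.k = 2)
    (hv : I.value = -1) {U : Finset (Fin I.n → Bool)} (hadd : ∀ x ∈ U, ∀ y ∈ U, bxor x y ∈ U)
    (r : Fin I.n → Bool) :
    (U.card : ℝ) * ∑ y ∈ univ.filter (fun y => ∀ x ∈ U, twist x (bxor r y) = 1),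
        signOf ((I.C (Fin.cast hk.symm 1)).eval y) =
      -(Real.sqrt ((2 : ℝ) ^ I.n) *
        ∑ x ∈ U, twist x r * signOf ((I.C (Fin.cast hk.symm 0)).eval x)) := by
  refine coset_sum_eq_of_forrelation_eq_neg_one ?_ hadd r
  rw [← KForrelationInstance.value_eq_forrelation hk, hv]

end DerivativeWalsh

end Literature.Computability.QuantumComplexity

end
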